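import Literature.RepresentationTheory.FiniteGroups.SymmetricGroupIsotypic
import HarnessLib

/-!
# Column orthogonality for the symmetric group

Topic `Literature/RepresentationTheory/FiniteGroups` (val-lit cell; brick B3a of the route to
IK 2020 Prop. 10.1 recorded in `HOME/bip/NOTE-t01g3-IK2020Prop101-P2-bricks.md`). Theorems only.

Serre, *Linear Representations of Finite Groups*, §2.5 Prop. 7 / Fulton–Harris Ex. 2.21 (the
second orthogonality relation, "column orthogonality"): for a finite group `G` and `s ∈ G`,
`∑_χ χ(s) χ(t)⋆ = |G|/|cl(s)|` if `t` is conjugate to `s` and `0` otherwise. For `G = 𝔖_n`, whose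
irreducible characters are the real-valued Specht characters `χ^μ`, `μ ⊢ n`
(`irrChars_perm_eq`, `star_spechtCharacter`), this reads

  `∑_{μ ⊢ n} χ^μ(x) χ^μ(z) = [x ∼ z] · n!/|cl(x)|`  (`sum_spechtCharacter_mul_spechtCharacter`),

proved as printed in Serre §2.5 (Remark after Thm. 6): expand the indicator function of the
class of `x` — a class function — in the orthonormal basis of irreducible characters
(`IsClassFun.eq_sum_classInner_smul`); its coefficient on `χ^μ` is `|cl(x)| χ^μ(x) / n!`.
§2 (`IsClassFun.sum_eq_sum_mul_card_inter_class_div`, any finite group): a class function summed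
over a subset `K` equals `∑_y f(y) |K ∩ cl(y)| / |cl(y)|` — the bookkeeping that turns column
orthogonality into counts of `K ∩ cl(y)`. §3 (`card_filter_isConj_piFinset`): in a direct product
`∏ H_i` these counts are products of the componentwise counts.

## References

* [SerreLinearRepresentations1977] J.-P. Serre, *Linear Representations of Finite Groups*,
  GTM 42, §2.5 (Thm. 6, Prop. 7).
* [FultonHarrisGTM129] W. Fulton, J. Harris, *Representation Theory*, GTM 129, Ex. 2.21, Thm. 4.3.
-/

noncomputable section

open scoped BigOperators

namespace Literature.RepresentationTheory.FiniteGroups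

open Literature.NumberTheory.DiophantineGeometry (spechtCharacter)

variable {n : ℕ}

/-- Conjugacy to `x` is invariant under conjugation of the second argument. [folklore] -/
private theorem isConj_conj_iff (x s t : Equiv.Perm (Fin n)) :
    IsConj x (t * s * t⁻¹) ↔ IsConj x s :=
  ⟨fun h => h.trans (isConj_iff.2 ⟨t⁻¹, by group⟩), fun h => h.trans (isConj_iff.2 ⟨t, rfl⟩)⟩

open Classical in
/-- The indicator function of a conjugacy class is a class function. [folklore] -/
private theorem isClassFun_indicator_isConj (x : Equiv.Perm (Fin n)) :
    IsClassFun (fun z : Equiv.Perm (Fin n) => if IsConj x z then (1 : ℂ) else 0) := by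
  intro s t
  simp only [isConj_conj_iff]

open Classical in
/-- The Fourier coefficient of the indicator of the class of `x` on `χ^μ` is
`|cl(x)| χ^μ(x) / n!` (Serre §2.5, Remark: `(f | χ) = c(s) χ(s)⋆ / g`; `χ^μ` is real and a class
function). [cite: SerreLinearRepresentations1977, §2.5 Prop. 7] -/
theorem classInner_indicator_isConj_spechtCharacter (x : Equiv.Perm (Fin n)) (μ : Nat.Partition n) :
    classInner (fun z : Equiv.Perm (Fin n) => if IsConj x z then (1 : ℂ) else 0)
        (spechtCharacter ℂ μ) =
      (Fintype.card (Equiv.Perm (Fin n)) : ℂ)⁻¹ *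
        ((Finset.univ.filter fun z : Equiv.Perm (Fin n) => IsConj x z).card : ℂ) *
          spechtCharacter ℂ μ x := by
  rw [classInner_apply, mul_assoc]
  congr 1
  rw [Finset.card_eq_sum_ones, Nat.cast_sum, Finset.sum_mul, Finset.sum_filter]
  refine Finset.sum_congr rfl fun s _ => ?_
  by_cases hs : IsConj x s
  · rw [if_pos hs, if_pos hs, one_mul, Nat.cast_one, one_mul, spechtCharacter_inv]
    obtain ⟨c, hc⟩ := isConj_iff.1 hs
    rw [← hc, Literature.NumberTheory.DiophantineGeometry.spechtCharacter_conj]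
  · rw [if_neg hs, if_neg hs, zero_mul]

open Classical in
/-- **Column orthogonality for `𝔖_n`** (second orthogonality relation, Serre §2.5 Prop. 7 /
Fulton–Harris Ex. 2.21, with the irreducible characters of `𝔖_n` = the Specht characters,
Fulton–Harris Thm. 4.3): `∑_{μ ⊢ n} χ^μ(x) χ^μ(z) = n!/|cl(x)|` if `z` is conjugate to `x`, and `0`
otherwise. [cite: SerreLinearRepresentations1977, §2.5 Prop. 7] -/
theorem sum_spechtCharacter_mul_spechtCharacter (x z : Equiv.Perm (Fin n)) :
    ∑ μ : Nat.Partition n, spechtCharacter ℂ μ x * spechtCharacter ℂ μ z =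
      if IsConj x z then
        ((n.factorial : ℕ) : ℂ) /
          ((Finset.univ.filter fun y : Equiv.Perm (Fin n) => IsConj x y).card : ℂ)
      else 0 := by
  set f : Equiv.Perm (Fin n) → ℂ := fun z => if IsConj x z then (1 : ℂ) else 0 with hf
  set cl : ℂ := ((Finset.univ.filter fun y : Equiv.Perm (Fin n) => IsConj x y).card : ℂ) with hcl
  have hcl0 : cl ≠ 0 := by
    rw [hcl, Nat.cast_ne_zero, ← pos_iff_ne_zero, Finset.card_pos]
    exact ⟨x, Finset.mem_filter.mpr ⟨Finset.mem_univ _, IsConj.refl x⟩⟩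
  have hG : (Fintype.card (Equiv.Perm (Fin n)) : ℂ) = ((n.factorial : ℕ) : ℂ) := by
    rw [Fintype.card_perm, Fintype.card_fin]
  have hG0 : ((n.factorial : ℕ) : ℂ) ≠ 0 := Nat.cast_ne_zero.mpr (Nat.factorial_ne_zero n)
  -- Fourier expansion of the class indicator, evaluated at `z`
  have hexp := (isClassFun_indicator_isConj x).eq_sum_classInner_smul
  have hz := congrFun hexp z
  rw [irrChars_toFinset_perm_eq, Finset.sum_image fun μ _ ν _ h => spechtCharacter_injective h,
    Finset.sum_apply] at hz
  simp only [Pi.smul_apply, smul_eq_mul, classInner_indicator_isConj_spechtCharacter, hG] at hz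
  -- `hz : f z = ∑ μ, (n!)⁻¹ * cl * χ^μ x * χ^μ z`
  have hsum : ∑ μ : Nat.Partition n, spechtCharacter ℂ μ x * spechtCharacter ℂ μ z =
      ((n.factorial : ℕ) : ℂ) * cl⁻¹ * f z := by
    simp only [hf]
    rw [hz, Finset.mul_sum]
    refine Finset.sum_congr rfl fun μ _ => ?_
    rw [← hcl]
    field_simp
  rw [hsum, hf]
  by_cases hxz : IsConj x z
  · simp only [if_pos hxz, mul_one, div_eq_mul_inv]
  · simp only [if_neg hxz, mul_zero]

/-! ### Class sums over a subset -/

section ClassSum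

variable {G : Type} [Group G] [Fintype G]

open Classical in
/-- **Summing a class function over a subset, class by class**: for a class function `f` and a
finite set `K ⊆ G`, `∑_{κ ∈ K} f(κ) = ∑_{y ∈ G} f(y) · |K ∩ cl(y)| / |cl(y)|` (each class `C`
contributes `f(C) · |K ∩ C|`). Serre §2.5 (class functions are the functions constant on
conjugacy classes; bookkeeping used with Prop. 7). [cite: SerreLinearRepresentations1977, §2.5 Prop. 7] -/
theorem IsClassFun.sum_eq_sum_mul_card_inter_class_div {f : G → ℂ} (hf : IsClassFun f)
    (K : Finset G) :
    ∑ κ ∈ K, f κ =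
      ∑ y : G, f y * ((K.filter fun κ => IsConj y κ).card : ℂ) /
        ((Finset.univ.filter fun z => IsConj y z).card : ℂ) := by
  -- conjugate elements have the same value and classes of the same size
  have hval : ∀ {y κ : G}, IsConj y κ → f y = f κ := by
    intro y κ h
    obtain ⟨c, hc⟩ := isConj_iff.1 h
    rw [← hc, hf]
  have hcl : ∀ {y κ : G}, IsConj y κ →
      (Finset.univ.filter fun z => IsConj y z) = Finset.univ.filter fun z => IsConj κ z := by
    intro y κ h
    exact Finset.filter_congr fun z _ => ⟨fun hz => h.symm.trans hz, fun hz => h.trans hz⟩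
  have hcl0 : ∀ y : G, ((Finset.univ.filter fun z => IsConj y z).card : ℂ) ≠ 0 := by
    intro y
    rw [Nat.cast_ne_zero, ← pos_iff_ne_zero, Finset.card_pos]
    exact ⟨y, Finset.mem_filter.mpr ⟨Finset.mem_univ _, IsConj.refl y⟩⟩
  -- expand `|K ∩ cl(y)|` as a sum over `K` and exchange
  have hstep : ∀ y : G, f y * ((K.filter fun κ => IsConj y κ).card : ℂ) /
      ((Finset.univ.filter fun z => IsConj y z).card : ℂ) =
      ∑ κ ∈ K, if IsConj y κ then
        f y / ((Finset.univ.filter fun z => IsConj y z).card : ℂ) else 0 := by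
    intro y
    rw [Finset.sum_ite, Finset.sum_const_zero, add_zero, Finset.sum_const, nsmul_eq_mul]
    ring
  rw [Finset.sum_congr rfl fun y _ => hstep y, Finset.sum_comm]
  refine Finset.sum_congr rfl fun κ _ => ?_
  rw [← Finset.sum_filter]
  have hK : ∀ y ∈ Finset.univ.filter (fun y : G => IsConj y κ),
      f y / ((Finset.univ.filter fun z => IsConj y z).card : ℂ) =
        f κ / ((Finset.univ.filter fun z => IsConj κ z).card : ℂ) := by
    intro y hy
    have h : IsConj y κ := (Finset.mem_filter.mp hy).2
    rw [hval h, hcl h]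
  rw [Finset.sum_congr rfl hK, Finset.sum_const, nsmul_eq_mul]
  have hsymm : (Finset.univ.filter fun y : G => IsConj y κ) =
      Finset.univ.filter fun z => IsConj κ z :=
    Finset.filter_congr fun z _ => isConj_comm
  rw [hsymm, mul_div_assoc', mul_div_cancel_left₀ _ (hcl0 κ)]

end ClassSum

/-! ### Conjugacy in a direct product is componentwise -/

section PiConj

variable {ι : Type} [Fintype ι] [DecidableEq ι] {H : ι → Type} [∀ i, Group (H i)]

omit [Fintype ι] [DecidableEq ι] in
/-- Conjugacy in `∏_i H_i` is componentwise conjugacy. [folklore] -/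
private theorem isConj_pi_iff (y κ : (i : ι) → H i) : IsConj y κ ↔ ∀ i, IsConj (y i) (κ i) := by
  constructor
  · intro h i
    obtain ⟨c, hc⟩ := isConj_iff.1 h
    exact isConj_iff.2 ⟨c i, by rw [← hc]; rfl⟩
  · intro h
    choose c hc using fun i => isConj_iff.1 (h i)
    exact isConj_iff.2 ⟨c, funext fun i => by simpa using hc i⟩

open Classical in
/-- **Counting a product set class by class**: in `∏_i H_i` the members of `∏_i K_i` conjugate to
`y` are counted componentwise, `|(∏ K_i) ∩ cl(y)| = ∏_i |K_i ∩ cl(y_i)|` (conjugacy in a direct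
product is componentwise; with `K_i = H_i` this is `|cl(y)| = ∏ |cl(y_i)|`, Serre §3.2, the
conjugacy classes / irreducible representations of a product). [cite: SerreLinearRepresentations1977, §3.2 Thm. 10] -/
theorem card_filter_isConj_piFinset [∀ i, Fintype (H i)] (y : (i : ι) → H i)
    (K : (i : ι) → Finset (H i)) :
    ((Fintype.piFinset K).filter fun κ => IsConj y κ).card =
      ∏ i, ((K i).filter fun κ => IsConj (y i) κ).card := by
  rw [← Fintype.card_piFinset]
  congr 1
  ext κ
  simp only [Finset.mem_filter, Fintype.mem_piFinset, isConj_pi_iff]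
  exact ⟨fun ⟨h1, h2⟩ i => ⟨h1 i, h2 i⟩, fun h => ⟨fun i => (h i).1, fun i => (h i).2⟩⟩

end PiConj

/-! ### Column orthogonality against a subset -/

section Subset

variable {n : ℕ}

open Classical in
/-- **Column orthogonality against a subset**: `∑_{μ ⊢ n} ∑_{κ ∈ K} χ^μ(y) χ^μ(κ) =
n! · |K ∩ cl(y)| / |cl(y)|` (`sum_spechtCharacter_mul_spechtCharacter` summed over `κ ∈ K`).
[cite: SerreLinearRepresentations1977, §2.5 Prop. 7] -/
theorem sum_sum_spechtCharacter_mul_eq (y : Equiv.Perm (Fin n)) (K : Finset (Equiv.Perm (Fin n))) :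
    ∑ μ : Nat.Partition n, ∑ κ ∈ K, spechtCharacter ℂ μ y * spechtCharacter ℂ μ κ =
      ((n.factorial : ℕ) : ℂ) * ((K.filter fun κ => IsConj y κ).card : ℂ) /
        ((Finset.univ.filter fun z : Equiv.Perm (Fin n) => IsConj y z).card : ℂ) := by
  have hpos : ∀ κ ∈ K.filter (fun κ => IsConj y κ),
      ∑ μ : Nat.Partition n, spechtCharacter ℂ μ y * spechtCharacter ℂ μ κ =
        ((n.factorial : ℕ) : ℂ) /
          ((Finset.univ.filter fun z : Equiv.Perm (Fin n) => IsConj y z).card : ℂ) := by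
    intro κ hκ
    rw [sum_spechtCharacter_mul_spechtCharacter, if_pos (Finset.mem_filter.1 hκ).2]
  have hneg : ∀ κ ∈ K.filter (fun κ => ¬IsConj y κ),
      ∑ μ : Nat.Partition n, spechtCharacter ℂ μ y * spechtCharacter ℂ μ κ = 0 := by
    intro κ hκ
    rw [sum_spechtCharacter_mul_spechtCharacter, if_neg (Finset.mem_filter.1 hκ).2]
  rw [Finset.sum_comm, ← Finset.sum_filter_add_sum_filter_not K (fun κ => IsConj y κ),
    Finset.sum_congr rfl hpos, Finset.sum_congr rfl hneg, Finset.sum_const, Finset.sum_const_zero,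
    add_zero, nsmul_eq_mul]
  ring

open Classical in
/-- The same with the subset sum distributed: `∑_μ χ^μ(y) (∑_{κ∈K} χ^μ(κ))`.
[cite: SerreLinearRepresentations1977, §2.5 Prop. 7] -/
theorem sum_spechtCharacter_mul_sum_eq (y : Equiv.Perm (Fin n)) (K : Finset (Equiv.Perm (Fin n))) :
    ∑ μ : Nat.Partition n, spechtCharacter ℂ μ y * ∑ κ ∈ K, spechtCharacter ℂ μ κ =
      ((n.factorial : ℕ) : ℂ) * ((K.filter fun κ => IsConj y κ).card : ℂ) /
        ((Finset.univ.filter fun z : Equiv.Perm (Fin n) => IsConj y z).card : ℂ) := by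
  rw [← sum_sum_spechtCharacter_mul_eq y K]
  exact Finset.sum_congr rfl fun μ _ => Finset.mul_sum _ _ _

open Classical in
/-- Class sizes are positive (as complex numbers: nonzero; `y ∈ cl(y)`).
[cite: SerreLinearRepresentations1977, §2.5 Prop. 7] -/
theorem card_filter_isConj_ne_zero (y : Equiv.Perm (Fin n)) :
    ((Finset.univ.filter fun z : Equiv.Perm (Fin n) => IsConj y z).card : ℂ) ≠ 0 := by
  rw [Nat.cast_ne_zero, ← pos_iff_ne_zero, Finset.card_pos]
  exact ⟨y, Finset.mem_filter.mpr ⟨Finset.mem_univ _, IsConj.refl y⟩⟩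

end Subset

end Literature.RepresentationTheory.FiniteGroups

end
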